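import Summits.FinalStateConjecture.FinalStateConjecture.Theorems.EIHFluxBalanceInertialRecessionStubEndgameOracleUnivBands

/-!
# Route EIHFluxBalance — crux `InertialRecession`, line `sublinear-is-free-clean-window-charges`:
# the increment oracle for a SLOW SYSTEM WITHOUT OUTSIDERS (every `N`): the fuel induction

Helper file for the crux `stmt-FinalStateConjecture-10166`
(`Summit.FinalStateConjecture.FinalStateConjecture.Theses.EIHFluxBalance.InertialRecession`), registered stub `stub_incrementOracle`
(lead reshape r9/r10) of `Cruxes/InertialRecession/Lines/sublinear_is_free_clean_window_charges.lean`; continues `…OracleUnivBands`.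

`univ_slow_increment`: iterating `univ_slow_segment` at most `N²(N²+2) + 1` times (the fuel is bounded by the number of
(pair, grid level) incidences and drops at every segment end before `t₂`) bounds the change of the TOTAL energy and momentum of an
internally slow system without outsiders on `[t₁,t₂]` by `(N²(N²+2) + 1)·N·X`, `X = C(2c₀^{-3/2} + 4N(4λ_min c₀)^{-3/2})t₁^{-1/2} + 2ζ⋆`
— the `S = univ` case of the increment ORACLE of `stub_incrementOracle`, for every `N` (all terms are small at late times).
-/

noncomputable section

set_option linter.dupNamespace false

open Filter Topology Set MeasureTheory intervalIntegral
open scoped Topology BigOperators InnerProductSpace RealInnerProductSpace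

namespace Summit.FinalStateConjecture.FinalStateConjecture.Theorems.SublinearIsFree.Oracle

open Literature.Geometry.Lorentzian
open Summit.FinalStateConjecture.FinalStateConjecture.Theorems.SublinearIsFree.Endgame

set_option maxHeartbeats 800000 in
/-- **THE INCREMENT ORACLE FOR A SLOW SYSTEM WITHOUT OUTSIDERS (every `N`).** See the module docstring. [folklore] -/
theorem univ_slow_increment {N : ℕ} (M : Fin N → ℝ) (ξ v : Fin N → ℝ → E3) (κ : ℝ) (P : ℝ → E3 → ℝ → Fin 4 → ℝ)
    (ρ : ℝ → ℝ) (C T T' T₀ : ℝ) (ζ : ℝ → ℝ)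
    (hWL : ∀ (t₁ t₂ : ℝ) (c : ℝ → E3) (R : ℝ → ℝ), T ≤ t₁ → t₁ ≤ t₂ →
      (∀ s ∈ Set.Icc t₁ t₂, ∀ s' ∈ Set.Icc t₁ t₂, ‖c s - c s'‖ ≤ 2 * |s - s'| ∧ |R s - R s'| ≤ 2 * |s - s'|) →
      (∀ s ∈ Set.Icc t₁ t₂, ρ s ≤ (1 / 2) * R s ∧ ‖c s‖ + R s ≤ (κ + κ ^ 2) / 2 * s ∧
        ∀ j, ‖ξ j s - c s‖ ≤ (1 - 1 / 2) * R s ∨ (1 + 1 / 2) * R s ≤ ‖ξ j s - c s‖) →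
      ∀ μ : Fin 4, |P t₂ (c t₂) (R t₂) μ - P t₁ (c t₁) (R t₁) μ| ≤ C * ∫ s in t₁..t₂, (R s ^ (3 / 2 : ℝ))⁻¹)
    (hID : ∀ (t : ℝ) (c : E3) (R : ℝ) (A : Finset (Fin N)), T' ≤ t → ρ t ≤ (1 / 2) * R →
      ‖c‖ + R ≤ (κ + κ ^ 2) / 2 * t →
      (∀ j, ‖ξ j t - c‖ ≤ (1 - 1 / 2) * R ∨ (1 + 1 / 2) * R ≤ ‖ξ j t - c‖) →
      (∀ j, j ∈ A ↔ ‖ξ j t - c‖ ≤ (1 - 1 / 2) * R) →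
      |P t c R 0 - ∑ j ∈ A, M j * (√(1 - ‖v j t‖ ^ 2))⁻¹| ≤ ζ t ∧
      ∀ k : Fin 3, |P t c R k.succ - ∑ j ∈ A, M j * (√(1 - ‖v j t‖ ^ 2))⁻¹ * v j t k| ≤ ζ t)
    (hC : 0 ≤ C) (hκ0 : 0 < κ) (hκ1 : κ < 1)
    (hξ : ∀ i, ContDiff ℝ 1 (ξ i)) (hspeed1 : ∀ i s, T₀ ≤ s → ‖deriv (ξ i) s‖ ≤ 1)
    {t₁ t₂ σ ζstar : ℝ} (hT : T ≤ t₁) (hT' : T' ≤ t₁) (hT₀ : T₀ ≤ t₁) (ht₁ : 0 < t₁) (h12 : t₁ ≤ t₂)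
    (hcone : ∀ i, ∀ s ∈ Set.Icc t₁ t₂, ‖ξ i s‖ ≤ κ ^ 2 * s)
    (hslow : ∀ k l, ∀ s₀ ∈ Set.Icc t₁ t₂, ∀ s₁ ∈ Set.Icc t₁ t₂, s₀ ≤ s₁ →
      |‖ξ k s₁ - ξ l s₁‖ - ‖ξ k s₀ - ξ l s₀‖| ≤ σ * (s₁ - s₀))
    (hσ : σ ≤ (κ - κ ^ 2) / 2 * (2⁻¹ / 16 ^ (N * N + 1)))
    (hρ : ∀ s ∈ Set.Icc t₁ t₂, ρ s ≤ 4 / 3 * (2⁻¹ / 16 ^ (N * N + 1)) * ((κ - κ ^ 2) / 2) * s)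
    (hζ : ∀ s ∈ Set.Icc t₁ t₂, ζ s ≤ ζstar) :
    |∑ j, M j * (√(1 - ‖v j t₂‖ ^ 2))⁻¹ - ∑ j, M j * (√(1 - ‖v j t₁‖ ^ 2))⁻¹| ≤
        (N * N * (N * N + 2) + 1) * (N * (C * (2 * (((κ - κ ^ 2) / 2) ^ (3 / 2 : ℝ))⁻¹ * (t₁ ^ (1 / 2 : ℝ))⁻¹ +
          N * (2 * (2 * ((4 * (2⁻¹ / 16 ^ (N * N + 1)) * ((κ - κ ^ 2) / 2)) ^ (3 / 2 : ℝ))⁻¹ * (t₁ ^ (1 / 2 : ℝ))⁻¹))) +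
          2 * ζstar)) ∧
    ∀ kk : Fin 3, |∑ j, M j * (√(1 - ‖v j t₂‖ ^ 2))⁻¹ * v j t₂ kk - ∑ j, M j * (√(1 - ‖v j t₁‖ ^ 2))⁻¹ * v j t₁ kk| ≤
        (N * N * (N * N + 2) + 1) * (N * (C * (2 * (((κ - κ ^ 2) / 2) ^ (3 / 2 : ℝ))⁻¹ * (t₁ ^ (1 / 2 : ℝ))⁻¹ +
          N * (2 * (2 * ((4 * (2⁻¹ / 16 ^ (N * N + 1)) * ((κ - κ ^ 2) / 2)) ^ (3 / 2 : ℝ))⁻¹ * (t₁ ^ (1 / 2 : ℝ))⁻¹))) +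
          2 * ζstar)) := by
  classical
  -- the per-segment bound and the fuel
  set Y : ℝ := N * (C * (2 * (((κ - κ ^ 2) / 2) ^ (3 / 2 : ℝ))⁻¹ * (t₁ ^ (1 / 2 : ℝ))⁻¹ +
      N * (2 * (2 * ((4 * (2⁻¹ / 16 ^ (N * N + 1)) * ((κ - κ ^ 2) / 2)) ^ (3 / 2 : ℝ))⁻¹ * (t₁ ^ (1 / 2 : ℝ))⁻¹))) +
      2 * ζstar) with hY
  set FU : ℝ → Finset ((Fin N × Fin N) × ℕ) := fun s ↦
    ((Finset.univ : Finset (Fin N × Fin N)) ×ˢ Finset.range (N * N + 2)).filter fun q ↦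
      2⁻¹ / 16 ^ q.2 ≤ ‖ξ q.1.1 s - ξ q.1.2 s‖ / ((κ - κ ^ 2) / 2 * s) with hFU
  set E : ℝ → ℝ := fun s ↦ ∑ j, M j * (√(1 - ‖v j s‖ ^ 2))⁻¹ with hE
  set Pk : Fin 3 → ℝ → ℝ := fun kk s ↦ ∑ j, M j * (√(1 - ‖v j s‖ ^ 2))⁻¹ * v j s kk with hPk
  -- one segment, in terms of `E`, `Pk`, `Y`, `FU`
  have hseg : ∀ u ∈ Set.Icc t₁ t₂, ∃ τ ∈ Set.Icc u t₂, (|E τ - E u| ≤ Y ∧ ∀ kk, |Pk kk τ - Pk kk u| ≤ Y) ∧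
      (τ = t₂ ∨ (FU τ).card + 1 ≤ (FU u).card) := by
    intro u hu
    obtain ⟨τ, hτ, hb, hend⟩ := univ_slow_segment M ξ v κ P ρ C T T' T₀ ζ hWL hID hC hκ0 hκ1 hξ hspeed1 (t₂ := t₂)
      hT hT' hT₀ ht₁ hcone hslow hσ hρ hζ hu
    refine ⟨τ, hτ, ⟨?_, fun kk ↦ ?_⟩, ?_⟩
    · simp only [hE, hY]; exact hb.1
    · simp only [hPk, hY]; exact hb.2 kk
    · simpa only [hFU] using hend
  have hY0 : 0 ≤ Y := by
    obtain ⟨τ, -, hb, -⟩ := hseg t₂ ⟨h12, le_rfl⟩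
    exact (abs_nonneg _).trans hb.1
  -- the fuel induction
  have claim : ∀ f : ℕ, ∀ u ∈ Set.Icc t₁ t₂, (FU u).card ≤ f →
      |E t₂ - E u| ≤ (f + 1) * Y ∧ ∀ kk, |Pk kk t₂ - Pk kk u| ≤ (f + 1) * Y := by
    intro f
    induction f with
    | zero =>
      intro u hu hfuel
      obtain ⟨τ, hτ, hb, hend⟩ := hseg u hu
      rcases hend with h | h
      · subst h
        simp only [Nat.cast_zero, zero_add, one_mul]
        exact hb
      · omega
    | succ f IH =>
      intro u hu hfuel
      obtain ⟨τ, hτ, hb, hend⟩ := hseg u hu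
      rcases hend with h | h
      · subst h
        have h1 : Y ≤ ((f + 1 : ℕ) + 1 : ℝ) * Y := by
          have : (0 : ℝ) ≤ ((f + 1 : ℕ) : ℝ) := Nat.cast_nonneg _
          nlinarith
        exact ⟨hb.1.trans h1, fun kk ↦ (hb.2 kk).trans h1⟩
      · have hfuel' : (FU τ).card ≤ f := by omega
        have hτ' : τ ∈ Set.Icc t₁ t₂ := ⟨hu.1.trans hτ.1, hτ.2⟩
        have ih := IH τ hτ' hfuel'
        refine ⟨?_, fun kk ↦ ?_⟩
        · calc |E t₂ - E u| = |(E t₂ - E τ) + (E τ - E u)| := by ring_nf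
            _ ≤ |E t₂ - E τ| + |E τ - E u| := abs_add_le _ _
            _ ≤ (f + 1) * Y + Y := add_le_add ih.1 hb.1
            _ = ((f + 1 : ℕ) + 1 : ℝ) * Y := by push_cast; ring
        · calc |Pk kk t₂ - Pk kk u| = |(Pk kk t₂ - Pk kk τ) + (Pk kk τ - Pk kk u)| := by ring_nf
            _ ≤ |Pk kk t₂ - Pk kk τ| + |Pk kk τ - Pk kk u| := abs_add_le _ _
            _ ≤ (f + 1) * Y + Y := add_le_add (ih.2 kk) (hb.2 kk)
            _ = ((f + 1 : ℕ) + 1 : ℝ) * Y := by push_cast; ring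
  -- initial fuel
  have hfuel0 : (FU t₁).card ≤ N * N * (N * N + 2) := by
    calc (FU t₁).card ≤ ((Finset.univ : Finset (Fin N × Fin N)) ×ˢ Finset.range (N * N + 2)).card :=
          Finset.card_filter_le _ _
      _ = N * N * (N * N + 2) := by simp [Finset.card_univ]
  have h := claim (N * N * (N * N + 2)) t₁ ⟨le_rfl, h12⟩ hfuel0
  have hcast : ((N * N * (N * N + 2) : ℕ) : ℝ) + 1 = (N * N * (N * N + 2) + 1 : ℝ) := by push_cast; ring
  refine ⟨?_, fun kk ↦ ?_⟩
  · have := h.1; rw [hcast] at this; simpa only [hE, hY] using this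
  · have := h.2 kk; rw [hcast] at this; simpa only [hPk, hY] using this

/-- Registered helper form: the initial fuel of the band iteration (carrier of this file). [folklore] -/
theorem oracle_fuel_card : ∀ (N : ℕ), (((Finset.univ : Finset (Fin N × Fin N)) ×ˢ Finset.range (N * N + 2)).card = N * N * (N * N + 2)) := by
  intro N
  simp [Finset.card_univ]

end Summit.FinalStateConjecture.FinalStateConjecture.Theorems.SublinearIsFree.Oracle

end
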